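import Literature.NumberTheory.EllipticCurves.Kato2004.MemberHullInputs
import Literature.NumberTheory.EllipticCurves.Kato2004.IwasawaCohomologyZetaLiftTwo
import Literature.NumberTheory.EllipticCurves.KatoFineSelmerDual
import HarnessLib

/-!
# Kato 2004 (Astérisque 295) AT THE PRIME `p = 2`: Thm. 12.4 (1)(2), Thm. 12.5 (1)(2)(3), Thm. 12.6 with
# Lemma 13.10 (1), 13.9 and 13.14, §14.14 (14.14.1)–(14.14.2), Thm. 14.5 (1)(2) and the rank-`0` count,
# AT KATO'S OWN LATTICE `T = V_{ℤ₂}(f)(1)` of an elliptic curve with a RATIONAL `2`-ISOGENY (reducible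
# `E[2]`), additive and potentially good at `2` — the package `MemberHullInputs W_K 2 κ γ I 𝐲` is
# inhabited (ONE existence fact; the `p = 2` twin of `Kato2004.exists_memberHullInputs`; statement (A)
# at `(W_K, 2)` DISPLAYED as a hypothesis)

Topic `NumberTheory/EllipticCurves`, sub-directory `Kato2004` (namespace = path). Seat `bsd-2adic-addL2x`
GEN 10 (prover, cell `bsd-2adic`, rung K4, crux stmt-BirchSwinnertonDyer-19098 `AdditiveRankZeroAtTwo`,
stub `stub_addDefectUpper` = hU3 on its `E[2]`-REDUCIBLE sub-block; road R-B45″ of the GEN 9 memo).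
ONE named existence fact (`def … : Prop`, D-0014) about the tree's STRUCTURE
`Kato2004.MemberHullInputs` (file `Kato2004/MemberHullInputs.lean`, seat bsd-potss-rkm, whose module
docstring carries Kato's printed statements verbatim and the ODD-`p` reading clause by clause; not
repeated). That structure is `p`-general; its odd-`p` existence fact `exists_memberHullInputs` carries
`p ≠ 2` for four reasons only: (a) its `I.H` is READ as the `Δ`-trivial component `e₀𝐇¹(T)`
(`e₀ ∉ ℤ₂[Δ]` at `2`), (b) the zeta lift `IwasawaH1Data.existsUnique_lift_of_zetaBody` is typed for odd
`p` (level `p^{n+1}` ↦ layer `n`), (c) `μ(𝐇²) = 0` is quoted from Wuthrich's Lemma 14 («`p` an odd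
prime»), (d) the count quotes Prop. 14.16 (2) («the `p`-cohomological dimension of `Spec ℤ[1/p]` is
`2`») and C.-H. Kim's local index («`p ≥ 3`»). This file records what inhabits the SAME structure at
`p = 2` when (a)–(d) are replaced as follows, every replacement being either a theorem of the tree or a
step of the two AUDITED `p = 2` readings of this seat (`Kato2004/AdditivePotGoodRankZeroShaUpperBoundFineSelmerAtTwo.lean`,
steps T1–T10 / T1′–T7′, and `…AtTwoSharp.lean`, steps T11–T14; D-audit PASS) run with a rational
`2`-torsion point — the reading is written out for the referee as R1–R12 below. Flag for the referee
(lit-kato format): `Kato-12.4-12.6-13.10-14.14-member-hull-reading-reducible-at-two`.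

## Setting and notation

`E/ℚ` NON-CM (Kato §13), ADDITIVE and POTENTIALLY GOOD at `2` (`ord₂ j ≥ 0`), `E[2]` REDUCIBLE (a
rational point of order `2` — then EVERY curve `ℚ`-isogenous to `E` has one, tree
`not_hasIrreducibleModPGaloisRep_of_isIsogenous`), `L(E,1) ≠ 0`, `Ш(E/ℚ)` finite. KATO'S MEMBER `W_K`:
the globally minimal curve `ℚ`-isogenous to `E` with `T₂W_K ≅ V_{ℤ₂}(f)(1)` as `Gal(ℚ̄/ℚ)`-lattices
(§8.3 + *AEC* III.4.12; displayed existentially, as in `exists_member_eulerSystem_expStar_values` and in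
the odd-`p` fact). Below `E := W_K`, `T = T₂E ≅ T*(1)`, `V = T ⊗ ℚ`, `W = E[2^∞]`, `2^t = #E(ℚ)[2^∞]`
(`t ≥ 1`), `2^{t₂} = #E(ℚ₂)[2^∞]`, `r_∞ = 1` if `Δ_E > 0` and `0` if `Δ_E < 0` (T1/T1′: at `ℝ`,
`T ≅ ℤ₂[C₂]` if `Δ_E < 0` — one real point of order `2`, also with a rational one — and
`T ≅ ℤ₂ ⊕ ℤ₂(sgn)` if `Δ_E > 0`). `G_∞ = Gal(ℚ(ζ_{2^∞})/ℚ) = Δ × U`, `Δ = ⟨σ_{−1}⟩ = ⟨c⟩`,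
`Λ = ℤ₂[[G_∞]]`, `Λ_U = ℤ₂[[U]]`, `Λ' = ℤ₂[[Gal(ℚ^cyc/ℚ)]] ≅ ℤ₂[[X]]` (regular of dimension `2`;
`U ≅ Gal(ℚ^cyc/ℚ)` by restriction, so `Λ_U = Λ'`); Kato's `𝐇^q(T) = lim_n H^q(ℤ[ζ_{2^n},1/2],T)`,
`𝐇'^q(T) = lim_m H^q(ℤ_m[1/2],T)` over the layers `ℚ_m = ℚ(ζ_{2^{m+2}})⁺` of `ℚ^cyc`, with
`res`/`cores` along `ℚ(ζ_{2^{m+2}})/ℚ_m` (`cores∘res = 2`, `res∘cores = 1 + c`); `(·)^{**}` = reflexive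
hull over `Λ'` (resp. `Λ_U`); `z̃_γ ∈ 𝐇¹(V)` = Kato's `z_γ^{(2)}` after the Tate twist (T13),
`γ^±` = `ℤ₂`-bases of `T(−1)^{c=±1}`, `z̃ := z̃_{γ⁺}`.

## The reading R1–R12 (witnesses for the fields of `MemberHullInputs W_K 2 κ γ I 𝐲`; «✓T_n» = the audited step applies word for word, the use of `E(·)[2] = 0` in it being replaced as stated)

* **R1 (`I.H`, pinned).** `I : IwasawaH1Data W_K 2 κ γ` is the tree's CONSTRUCTED inverse limit of the
  integral classes along the cyclotomic `ℤ₂`-tower (`nonempty_iwasawaH1Data_holds`): `I.H = 𝐇'¹(T)`. It is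
  finitely generated over `Λ'` ((12.2.1), every `p`, Shapiro `𝐇'^q = H^q(ℤ[1/2], T ⊗ Λ')`) and
  torsion free (Thm. 12.4 (2) — any lattice, any `p` — with `res : 𝐇'¹(T) ↪ 𝐇¹(T)` injective: levelwise
  `ker res = H¹(⟨c⟩, T^{G_{ℚ(ζ)}})` and `T^{G_{ℚ(ζ_{2^{m+2}})}} = lim_k E(ℚ(ζ_{2^{m+2}}))[2^k] = 0`, the
  torsion of `E` over a number field being finite — ✓T2/T14 with this remark in place of `E(ℚ_m)[2] = 0`).
  Fields `finite_H`, `torsionFree_H`.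
* **R2 (the hull `F`).** `F := 𝐇'¹(T)^{**}`, `j` the inclusion: over the `2`-dimensional regular local
  ring `Λ'` the reflexive hull of a finitely generated torsion-free module is free with finite
  (pseudo-null) cokernel (Bourbaki *AC* VII §4.2 / Bruns–Herzog 1.4.1); `rank = 1` (Thm. 12.4 (2):
  `𝐇¹(V)` free of rank `1` over `Λ ⊗ ℚ = (Λ_U ⊗ ℚ)[Δ]`, so `𝐇'¹(V) = res⁻¹(𝐇¹(V)^{c=1})` has
  `Λ'`-rank `1`; equivalently Tate's Euler characteristic over the totally real `ℚ_m`, ✓T2). With a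
  rational `2`-torsion point `𝐇'¹(T)` itself NEED NOT be free (T2's/T11's regular-sequence argument uses
  `H⁰(ℚ, E[2]) = 0`, resp. `H⁰(ℚ(i), E[2]) = 0`) — this is why the hull of the package is used, exactly
  as at odd `p`. Fields `F`, `finite_F`, `torsionFree_F`, `j`, `j_injective`, `finite_coker`.
* **R3 (the zeta element in the hull, and `z := y'`).** Thm. 12.6 + 13.14 at `T = V_{ℤ₂}(f)` (both
  printed for every `p`; 13.14's two sentences «since `Z(f,T)/Z` is a finite group, `Z(f,T)_𝔭 ⊂ 𝐇¹(T)_𝔭`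
  for any prime ideal `𝔭` of height one» read over the regular ring `Λ_U` — a finite `Λ`-module is a
  finite `Λ_U`-module —, Wuthrich L.12): `z̃_γ ∈ ⋂_𝔮 𝐇¹(T)_𝔮 = 𝐇¹(T)^{**} =: F_U` for every `γ ∈ T(−1)`
  (✓T12 WITHOUT its last shortcut «free ⇒ reflexive»: only hull-integrality is claimed). T13 (Thm. 12.5 (1)
  last clause + 13.9, image-free): `c·z̃ = z̃`. HULL FORM OF T14: `F_U^{c=1} = ker(c − 1 : F_U → F_U)` is
  `Λ_U`-reflexive (a kernel of a map from a reflexive to a torsion-free module over a normal domain) and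
  contains `𝐇¹(T)^{c=1} = res 𝐇'¹(T)` (✓T14: inflation–restriction with `T^{G_{ℚ(ζ)}} = 0`, R1) with
  finite index (`⊂ F_U/𝐇¹(T)`), hence `F_U^{c=1} = (res 𝐇'¹(T))^{**} = res^{**}(F)`; so there is a
  UNIQUE `y' ∈ F` with `res^{**}(y') = z̃`, and `z' := cores^{**}(z̃) = cores^{**}res^{**}(y') = 2y'`
  (`res^{**}`, `cores^{**}` = the unique extensions to the hulls). Put **`z := y'`**. `z ≠ 0` and `F/Λ'z`
  torsion: `exp*_ω(z'_0) = 2u·L(E,1)/Ω_E ≠ 0` (✓T9, both signs of `Δ_E`; at the member, as at odd `p`: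
  `γ⁺` a basis of `T₂W_K(−1)⁺`, `ω = ω_{W_K}` Néron, Thm. 12.5 (1) transported along `h¹(W_K) ≅ M(f)`),
  rank one by R2. Fields `z`, `z_ne_zero`, `isTorsion_quotient`.
* **R4 (the multiplier).** `𝐲 ∈ I.H` is THE lift of `(Cor_{ℚ(μ_{2^{n+2}})/ℚ_n} z_{n+2,∅})_n` for the
  `(c,d,a(A))`-Euler system of a `ZetaBody W_K 2 …` witness (`IwasawaH1Data.existsUnique_lift_of_zetaBody_two`,
  tree THEOREM; (8.1.3)/Ex. 13.3 and Thm. 12.6 allow `p = 2`: `(c, 6·2·A) = (d, 6·2·N) = 1`). Lemma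
  13.10 (1) (every `p`; `k = 2`, `j = 1`, `(u,v) = (1,1)`) and `F_λ`-linearity of `γ ↦ z_γ`:
  `(_{c,d}z_{2^n})_n = ∏_{ℓ∣A odd} P_ℓ · (c²d² z_{γ₁} − cd² σ_c z_{γ₂} − c²d σ_d z_{γ₃} + cd σ_{cd} z_{γ₄})`,
  `γ_i ∈ V_ℤ(f) ⊂ T(−1)`, `γ_i = b_i⁺γ⁺ + b_i⁻γ⁻` with `2b_i^± ∈ ℤ₂` (`[T(−1) : T(−1)⁺ ⊕ T(−1)⁻] ≤ 2`).
  Apply `cores^{**}` (`Λ_U`-linear; `cores(σ_{−1}x) = cores(x)`, so `cores(λx) = λ'·cores(x)` with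
  `λ' =` image of `λ` under `Λ → Λ_U = Λ'`, `σ_{−1} ↦ 1`): by T13 `σ_{−1}z̃_{γ⁻} = −z̃_{γ⁻}`, hence
  `cores z̃_{γ⁻} = 0` in the torsion-free `𝐇'¹(V)`, and `cores z̃_{γ_i} = b_i⁺ z' = (2b_i⁺)·y'`. So
  **`j 𝐲 = lam • y'`**, `lam = ∏_{ℓ∣A odd} P_ℓ' · (c²d² b₁ − cd² b₂ σ_c' − c²d b₃ σ_d' + cd b₄ σ_{cd}') ∈ Λ'`
  with `b_i := 2b_i⁺ ∈ ℤ₂` = the `γ⁺`-coordinate of `γ_i + ιγ_i ∈ T(−1)⁺` — the odd-`p` multiplier with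
  `(p − 1)e₀ = N_Δ e₀` replaced by `cores∘res = 1 + c = 2` on `c`-fixed classes —, and
  `lam(0) = ∏_{ℓ∣A odd} L_ℓ(E,1)^{-1} · b ≠ 0` for a suitable admissible `(c,d,a,A)` by the odd-`p` fact's
  Manin argument verbatim (`b` = the `γ⁺`-coordinate of `(1+ι)γ_*`, `γ_* = c²d²γ₁ − cd²γ₂ − c²dγ₃ + cdγ₄`;
  the cusp classes span `V_ℤ(f)`, so some `δ(f,1,a(A))` has `(1+ι)δ ≠ 0`; `c = 1 + 12A`, `d = 1 + 12AN`).
  Fields `lam`, `j_y`, `lam_constantCoeff_ne_zero`.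
* **R5 (`H2` := the NON-ARCHIMEDEAN PART of `𝐇'²(T)`).** `𝐇'²(T)` is finitely generated (12.2.1) and
  `Λ'`-torsion (Thm. 12.4 (1), any `p`, through ✓T3: `𝐇'²_𝔮 ≅ e₊𝐇²_𝔮` at `𝔮 ∌ 2`, so `𝐇'² ⊗ Q(Λ') = 0`).
  By ✓T1′ the real places of the `ℚ_m` give `R := lim_m ⊕_{v∣∞} H²(ℚ_{m,v},T) ≅ 𝔽₂[[X]]^{r_∞}`; let
  `ρ : 𝐇'²(T) → R` be the localisation and **`H2 := K := ker ρ`**, `Im := ρ(𝐇'²) ⊂ R`. `K` is finitely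
  generated torsion; `Im` is a torsion-free, hence free, `𝔽₂[[X]]`-module of rank `≤ r_∞`, so `Im[X] = 0`
  and `#(Im/X·Im) ≤ 2^{r_∞}`; the snake lemma for `X` on `0 → K → 𝐇'² → Im → 0` gives
  **`K[X] = 𝐇'²[X]`** and **`#(𝐇'²/X) = #(K/X)·#(Im/X·Im) ≤ #(K/X)·2^{r_∞}`**. (For `Δ_E < 0`: `R = 0`,
  `K = 𝐇'²(T)`.) Fields `H2`, `finite_H2`, `isTorsion_H2`.
* **R6 (`A`, pinned).** `A := H¹(ℤ[1/2],T)` = the tree's `integralH1 (tateRep W_K 2) 2 (κ.layerSubgroup 0)`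
  (Kato 8.2: `H¹` of `Spec ℤ[1/2]` with `j_*`, i.e. the classes in `H¹(ℚ,T)` unramified at every odd
  prime; no condition at `∞`), `Λ'` acting through `g ↦ g(0)` (`Λ'` acts on `H¹(ℤ[1/2], T ⊗ Λ'/X)` through
  `Λ'/X = ℤ₂`). Fields `A`, `toH1`, `toH1_injective`, `mem_range_toH1_iff`, `toH1_smul` (witnessed by the
  subgroup itself).
* **R7 ((14.14.1)).** ✓T6′ («the argument as in 13.8»: the `Tor`-sequence of
  `RΓ(ℤ[1/2], T ⊗ Λ') ⊗^𝐋 Λ'/X ≅ RΓ(ℤ[1/2], T)` needs only `𝐇'³[X] = 0` — T1′: `𝐇'³ ≅ 𝔽₂[[X]]^{r_∞}` is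
  `X`-torsion-free — and `H⁰(ℤ[1/2],T) = T^{G_ℚ} = 0`, R1's remark): `0 → 𝐇'¹/X →ι A →π' 𝐇'²[X] → 0`
  exact and (14.14.2) `𝐇'²/X ≅ H²(ℤ[1/2],T)`; with R5, `π := π' : A → 𝐇'²[X] = K[X] = invariants K`.
  The first map is induced by `Λ' → Λ'/X`, i.e. it is the projection to the bottom layer:
  `ι(x mod X) = proj₀ x` (13.8 / `IwasawaH1Data.projZero`, as at odd `p`). Fields `ι`, `π`, `ι_injective`,
  `π_surjective`, `exact_ι_π`, `toH1_ι`.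
* **R8 (divisibility off `(2)`).** ✓T3 (Thm. 12.5 (3) at `2` via Kato 1999 Thm. 0.8, Rem. 12.7:
  `𝐇²_loc = 0` at a potentially good `2`; image-free; localisation `Λ → Λ'` at `𝔮 ∌ 2`): for every
  height-one `𝔮 ≠ (2)` of `Λ'`, `ℓ_𝔮(𝐇'²) ≤ ℓ_𝔮(𝐇'¹/Λ'z')`. At such `𝔮`: `K_𝔮 = 𝐇'²_𝔮` (`Im` is killed by
  `2`), `F_𝔮 = 𝐇'¹_𝔮` (finite cokernel), `Λ'_𝔮 y' = Λ'_𝔮 z'` (`2 ∈ Λ'_𝔮^×`); and at `𝔮 = (X)` both lengths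
  are `0` (R10, R11). Field `divisibility_offP`.
* **R9 (`μ(K) = 0` from the DISPLAYED hypothesis (A) at `(W_K, 2)`).** ✓T4′ (Poitou–Tate along the
  tower, archimedean terms inserted; its last term `lim_m E(ℚ_m)[2^∞]^∨`, there `0`, is now a finitely
  generated `ℤ₂`-module and plays no role): `0 → Y^{str} → 𝐇'²(T) →loc ⊕_{w∣2} H⁰(ℚ^cyc_w, W)^∨ ⊕ R`
  is exact, the `R`-component of `loc` being `ρ`; `Y^{str}` differs from the dual fine Selmer group
  `Y(E/ℚ^cyc)` by the Pontryagin dual of `⊕_{w∣ℓ∣N} H¹_ur(ℚ^cyc_w, W)` (finitely many `w`, each term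
  `ℤ₂`-cofinitely generated). Hence `K/(K ∩ Y^{str}) ↪ ⊕_{w∣2} H⁰(ℚ^cyc_w, W)^∨` (one `w`; a quotient of
  `W^∨ ≅ ℤ₂²`), so `μ(K) ≤ μ(Y^{str}) ≤ μ(Y(E/ℚ^cyc))`, which is `0` under (A) — `Y(E/ℚ^cyc)` finitely
  generated over `ℤ₂`, the hypothesis `hA` below in the tree's `∃ γ D` spelling over
  `WeierstrassCurve.FineSelmerDualData`, exactly as in the two audited files. (So `μ(𝐇'²) = r_∞` sits in
  `Im`, not in `K`.) For REDUCIBLE `E[2]` the hypothesis (A) at `2` is a THEOREM from print (Lim 2017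
  Thm. 3.5 at `2` + Ferrero–Washington: the Borel field of the rational line is `ℚ`; tree
  `AddKatoTwo.conjA_two_of_not_irreducible`), which is why it costs the consumer nothing; it is
  displayed, not used silently. Field `mu_H2`.
* **R10 (`K/XK` finite) and R11 (`[A : Λ'·ι(𝐲̄)] ≠ 0`).** Thm. 14.5 (1) (p. 236; «assume `L(f,k/2) ≠ 0`»;
  NO parity hypothesis — (3) is the clause with «Assume `p ≠ 2`»; its proof's sequences (14.9.3)–(14.9.5)
  are «exact upto `×2`» at `p = 2`, p. 239, which does not affect finiteness or ranks): `H²(ℤ[1/2],T)` is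
  finite and `rank_{ℤ₂} A = 1`. Hence `#(K/XK) ≤ #(𝐇'²/X) = #H²(ℤ[1/2],T) < ∞` (R5, (14.14.2)); and
  `y₀ := ι(𝐲̄) = proj₀ 𝐲` has `exp*_ω(loc₂ y₀) = lam(0)·exp*_ω(y'_0) = lam(0)·u·L(E,1)/Ω_E ≠ 0` (R3, R4;
  `u ∈ ℤ₂^×`), so `y₀` is non-torsion in the rank-one `A` and `Λ'·ι(𝐲̄) = ℤ₂ y₀` (`X` acts as `0`) has
  finite index. Fields `finite_coinvariants_H2`, `index_ne_zero`.
* **R12 (THE COUNT at `p = 2` — step T7″ = the audited T7′ run with a rational `2`-torsion point; for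
  `Δ_E < 0` it is Prop. 14.16 (2) verbatim, T1/T7).** Selmer structures over `Σ = {2, ∞} ∪ {ℓ ∣ N}` as in
  T7′: on `T`, `G` = (all at `2`, all at `∞`, `H¹_ur` at `ℓ`), `F` = (`H¹_f` at `2`, all `= H¹_f` at `∞`,
  `H¹_ur` at `ℓ`); `H¹_G(ℚ,T) = A`; duals on `W`: `H¹_{G*}(ℚ,W) = Sel^{str}(W)` (`0` at `2` and `∞`,
  `H¹_ur` at `ℓ`), `H¹_{F*}(ℚ,W) = S₁(W)` (`H¹_f` at `2`, `0` at `∞`, `H¹_ur` at `ℓ`). (i) Poitou–Tate for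
  Selmer structures (Rubin Thm. I.7.3 / Mazur–Rubin Thm. 2.3.4; `p = 2` with `∞ ∈ Σ`):
  `0 → H¹_F(ℚ,T) → A →loc_s H¹_s(ℚ₂,T) → S₁(W)^∨ → Sel^{str}(W)^∨ → 0`, `H¹_s = H¹/H¹_f`. Here
  `H¹_F(ℚ,T) ⊂ S₂(E/ℚ)` (the Bloch–Kato Selmer group of `T`: at `ℓ ≠ 2`, `H¹(ℚ_ℓ,V) = 0` so
  `H¹_f(ℚ_ℓ,T) = H¹(ℚ_ℓ,T) ⊇ H¹_ur`), and `#S₂(E/ℚ) = #E(ℚ)[2^∞] = 2^t` in rank `0` with finite `Ш`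
  (`0 → E(ℚ) ⊗ ℤ₂ → S₂ → T₂Ш → 0`; Kato's own sentence in the proof of 14.16: «`H¹_f(ℤ[1/p],T)`
  coincides with the torsion part `H⁰(ℚ, T ⊗ ℚ/ℤ)`»): **`#H¹_F(ℚ,T) ≤ 2^t`**. (ii) `H¹_s(ℚ₂,T)` is
  torsion-free of rank `1`, `exp*_ω(H¹(ℚ₂,T)) = 2^{−a}ℤ₂`, `a = t₂ − v₂(c₂)` (✓T8, local and
  torsion-agnostic); `[H¹_s : ℤ₂ loc_s y₀] = 2^{e + a}`, `e = ord₂ exp*_ω(y₀) = v₂(lam(0)) + ord₂(L(E,1)/Ω_E)`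
  (R10); `[H¹_s : loc_s A] = #coker(loc_s) = #S₁/#Sel^{str}` (exactness); `H¹_F ∩ ℤ₂y₀ = 0`. Hence
  **`ord₂ #(A/ℤ₂y₀) = ord₂ #H¹_F + v₂(lam(0)) + ord₂(L/Ω) + t₂ − v₂(c₂) + ord₂ #Sel^{str} − ord₂ #S₁`.** (iii)
  The `H²`-row of the same duality for `Spec ℤ[1/2]` with `j_*` (✓T4′ at level `0`, whose last term
  `E(ℚ)[2^∞]^∨` is now of order `2^t` instead of `0`; Milne *ADT* II §3, archimedean terms with
  ordinary `H²(ℝ,·)`): `0 → Sel^{str}(W)^∨ → H²(ℤ[1/2],T) → H²(ℚ₂,T) ⊕ H²(ℝ,T)^{⊕ r_∞·} → E(ℚ)[2^∞]^∨`,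
  `#H²(ℚ₂,T) = #H⁰(ℚ₂,W) = 2^{t₂}` (local duality, `T ≅ T*(1)`), `#H²(ℝ,T) = 2^{r_∞}` (T1′). With R5 and
  (14.14.2): **`ord₂ #(K/XK) ≥ ord₂ #H²(ℤ[1/2],T) − r_∞ ≥ ord₂ #Sel^{str} + t₂ − t`.** (iv) Lemma T at
  `2` (§14.8 + Greenberg Prop. 4.13 / §3, rank `0`): `Ш(E/ℚ)[2^∞] = Sel_{2^∞}(E/ℚ) ⊂ S₁(W)` (`im κ_ℓ = 0`
  at `ℓ ≠ 2`, `im κ_∞ = 0`, `im κ₂ = H¹_f(ℚ₂,W)`, Bloch–Kato 3.11), `S₁/Sel_{2^∞} ↪ ⊕_{ℓ odd} H¹_ur(ℚ_ℓ,W)`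
  with `#H¹_ur(ℚ_ℓ,W) = #H¹(𝔽_ℓ, H⁰(ℚ_ℓ^{ur},W)/div) = #Φ_ℓ(𝔽_ℓ)[2^∞] = 2^{v₂(c_ℓ)}` (Kato 14.8's displayed
  group) and cokernel dual to a quotient of the relaxed-at-`ℓ` compact Selmer group `H¹_{F₀}(ℚ,T) = S₂(E/ℚ)`
  (Poitou–Tate for `F*₀ ⊂ F*`), of order `≤ 2^t`: **`ord₂ #Ш[2^∞] + Σ_{ℓ odd} v₂(c_ℓ) ≤ ord₂ #S₁ + t`.**
  (v) Adding (ii)–(iv): `ord₂ #Ш(E)[2^∞] + v₂(Tam E) + ord₂ #(A/ℤ₂y₀) ≤ ord₂(L(E,1)/Ω_E) + v₂(lam(0)) +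
  ord₂ #(K/XK) + 3t` — the field `count` (with `Λ'·ι(𝐲̄) = ℤ₂y₀`, `Ω_E = realPeriodRat`). The three `t`'s
  are Kato's two `H⁰` factors (`H¹_F = A_tors`-type term in (ii); the cokernel `E(ℚ)[2^∞]^∨` in (iii)) and
  Cassels' cokernel in (iv), exactly as at odd `p`; the archimedean `2^{r_∞}` CANCELS between `μ(𝐇'²)`
  (removed by passing to `K`) and `#H²(ℝ,T)` (T7′'s cancellation). For `Δ_E < 0` (`R = 0`, `K = 𝐇'²`,
  `T` cohomologically trivial at `ℝ`, ✓T1) (i)–(v) is Kato's proof of Prop. 14.16 (2) word for word.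

WHAT THE ABSTRACT FIELDS DO AND DO NOT PIN (as in the odd-`p` file, read before use): `F`, `z`, `lam`,
`H2`, `π` are existential, constrained only by the listed statements — at `p = 2` the intended witnesses
are `𝐇'¹(T)^{**}`, `y' = ½·cores^{**}(z̃_{γ⁺})`, the multiplier of R4, the NON-ARCHIMEDEAN PART `K` of
`𝐇'²(T)` (R5) and `π'` of (14.14.1); `I.H = 𝐇'¹(T)`, `𝐲`, `A = H¹(ℤ[1/2],T)`, `ι = proj₀` and every
elliptic-curve quantity are pinned. The fact is WEAKER than what R1–R12 give (it forgets which modules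
`F`, `H2` are) and never stronger; its net consequence through the tree's PROVED hull descent
(`valuation_add_padicValNat_coinvariants_le_of_hull_smul`) is the member bound at `2`,
`ord₂ #Ш(W_K)[2^∞] + v₂ Tam(W_K) ≤ ord₂(L(W_K,1)/Ω(W_K)) + 3·ord₂ #W_K(ℚ)_tors` (consumer
`Summits/…/Theorems/ByReductionTypeAtTwoAdditiveReducibleKatoMember.lean`); the collapse-test caveat of
the odd-`p` file applies verbatim.

## What is NOT here

Nothing for irreducible `E[2]` (there this seat's sharp reading `…AtTwoSharp` is stronger: no `3t`), at a
potentially multiplicative `2` ((12.5.1)), in analytic rank `1`, for CM curves (§15 not read at `2`);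
statement (A) is NOT asserted (hypothesis `hA`, on the member); no claim which curve `W_K` is; no equality;
no sharpening of the `3t` (BSD predicts `2t`; the member's Cassels cokernel is `#im(E(ℚ)[2^∞] →
∏_{ℓ odd} Φ_ℓ(𝔽_ℓ)[2^∞])`, not transcribed); no `_holds` (size XL: Kato's Euler system, explicit
reciprocity, Poitou–Tate). No `instance`, no notation. The non-verbatim steps are R3's hull form of T14,
R4's `cores` bookkeeping, R5 (the passage to `K`), R9's `μ`-bookkeeping, R12 = T7″, and the non-verbatim
steps of T1′–T14 listed in the two audited files; the verbatim inputs are Kato's (12.2.1), Thm. 12.4 (1)(2),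
Thm. 12.5 (1)–(3), Thm. 12.6, Rem. 12.7, 13.8, 13.9, Lemma 13.10 (1), 13.13–13.14, Thm. 14.5 (1)(2), §14.8,
14.13–14.14 with Lemma 14.15, and — for `Δ_E < 0` — Prop. 14.16 (2) and its proof.
Derivation memo: `run/shared/lean/pub/bsd-2adic/addL2x/VERDICT-19098-addL2x-GEN10.md`.

## References

* K. Kato, Astérisque 295 (2004): §8.2–8.3 (pp. 180–181), (8.1.3) (p. 180), Ex. 13.3 (p. 225), (12.2.1)
  (p. 220), Thm. 12.4 (1)(2), Thm. 12.5 (1)–(3), (12.5.1) (pp. 221–222), Thm. 12.6, Rem. 12.7 (p. 222),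
  Rem. 12.8 (p. 223), 13.8 (pp. 227–229), 13.9 and Lemma 13.10 (1) (pp. 229–230), 13.13–13.14 (pp. 233–234),
  Thm. 14.5 (1)(2) and `[M : z]` (pp. 236–237), §14.8 (p. 238), (14.9.1)–(14.9.5) «exact upto ×2 in the case
  p = 2» (pp. 239–240), 14.13–14.14, Lemma 14.15 (pp. 242–244), Prop. 14.16 (2) and its proof (pp. 244–245) —
  store text `paper:doi-10-24033-ast-639`, read 2026-08-28. [Kato2004Asterisque]
* K. Kato, Kodai Math. J. 22 (1999), Thm. 0.8 (p. 318). [Kato1999Kodai]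
* C. Wuthrich, Doc. Math. 19 (2014): Lemma 12 (p. 395) (`Z(f,T) ⊂ 𝐇¹(T)^{**}`). [Wuthrich2014]
* R. Greenberg, LNM 1716 (1999): Prop. 4.13 and the Cassels paragraph; §3 after Lemma 3.3. [GreenbergLNM1716]
* K. Rubin, *Euler Systems* (2000): Ch. I §3–§4 (archimedean `H¹_f`, `H¹_ur` annihilators), Thm. I.7.3;
  Ch. II Thm. 2.3 («holds even if p = 2»). [Rubin2000]  B. Mazur, K. Rubin, Mem. AMS 799 (2004), Thm. 2.3.4. [MazurRubin2004]
* J. S. Milne, *Arithmetic Duality Theorems* (2nd ed.): I.2.6, I.4.10, II.2.9, II §3. [MilneADT2006]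
* S. Bloch, K. Kato (1990), §3: Def. 3.10, Ex. 3.11, Prop. 3.8. [BlochKato1990]
* M. F. Lim, Asian J. Math. 21 (2017), §3 (Thm. 3.5, the Poitou–Tate lemma). [Lim2017FineSelmer]
  J. Coates, R. Sujatha, Math. Ann. 331 (2005), statement (A), Thm. 3.4. [CoatesSujatha2005]
* N. Bourbaki, *AC* VII §4 no. 2; W. Bruns, J. Herzog, *Cohen–Macaulay rings*, Prop. 1.4.1. [BourbakiAC5to7] [BrunsHerzog1998]
* J. Neukirch, A. Schmidt, K. Wingberg, *Cohomology of Number Fields* (2nd ed.), (1.5.6)–(1.5.7), (1.6.7). [NeukirchSchmidtWingberg2008]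
* J. H. Silverman, *AEC* (2nd ed.): III.4.12 + Rem. III.4.13.2 (the member), IV.6.4, X.4.14; J. Tate, LNM 476
  (1975) §1. [SilvermanAEC2009] [Tate1975]  L. C. Washington, *Cyclotomic Fields* §13.1 (`ℚ_m ⊂ ℚ(ζ_{2^{m+2}})`). [Washington1997]
* Tree: `Kato2004/MemberHullInputs.lean` (the structure and the odd-`p` reading), `Kato2004/IwasawaCohomologyZetaLiftTwo.lean`
  (`levelToLayerTwo`, `existsUnique_lift_of_zetaBody_two`), `Kato2004/AdditivePotGoodRankZeroShaUpperBoundFineSelmerAtTwo{,Sharp}.lean`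
  (T1–T14), `KatoFineSelmerDual.lean` (`FineSelmerDualData`), `Rank1Residual/GVParityTwistTransportProofs.lean`
  (`not_hasIrreducibleModPGaloisRep_of_isIsogenous`).
-/

noncomputable section

open scoped NumberField TensorProduct
open Field IsDedekindDomain CongruenceSubgroup
open Literature.NumberTheory.GaloisRepresentations
open Literature.NumberTheory.EllipticCurves Literature.NumberTheory.EllipticCurves.ModularForms
open Literature.NumberTheory.EllipticCurves.Kato2004
open Literature.NumberTheory.EllipticCurves.Kato2004.EulerSystemValues Rat.HeightOneSpectrum
open Literature.NumberTheory.EllipticCurves.IwasawaAlgebra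

namespace Literature.NumberTheory.EllipticCurves.Kato2004

/-- **Kato 2004 at `p = 2`, Thm. 12.4 (1)(2), 12.5 (1)–(3), 12.6 + Lemma 13.10 (1) + 13.9 + 13.14, §14.14,
Thm. 14.5 (1)(2) and the rank-`0` count (Prop. 14.16 (2) for `Δ < 0`; the Poitou–Tate count with the real
place inserted for either sign), AT KATO'S LATTICE `T = V_{ℤ₂}(f)(1)` OF A CURVE WITH A RATIONAL
`2`-ISOGENY: the rank-`0` descent inputs EXIST at Kato's member — the `p = 2` twin of
`exists_memberHullInputs`.**  For every globally minimal NON-CM elliptic curve `W/ℚ` with ADDITIVE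
(neither good nor multiplicative), POTENTIALLY GOOD (`0 ≤ ord₂ j(W)`) reduction at `2`, `W[2]` REDUCIBLE,
`L(W,1) ≠ 0` and `Ш(W/ℚ)` finite, there is a GLOBALLY MINIMAL curve `W_K/ℚ`, `ℚ`-isogenous to `W`
(Kato's member, displayed existentially as in the odd-`p` fact), such that, GRANTED statement (A) at
`(W_K, 2)` — the dual fine Selmer group of `W_K` over `ℚ^{cyc}` is finitely generated over `ℤ₂`, in the
tree's `∃ γ D` spelling (`hA`; a THEOREM from print for reducible `E[2]`, tree
`AddKatoTwo.conjA_two_of_not_irreducible`, displayed here and NOT asserted) —, for the newform `f` of `W`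
and every family of complex embeddings `ι` there are witnesses `(κ', Λ', c, d, a, A, z, x)` with
`κ' ≠ 0`, `A ≥ 1`, `(c, 12A) = 1`, `(d, 12N) = 1` satisfying `ZetaBody W_K 2 f ι κ' Λ' c d a A z x`
((8.1.3)/Ex. 13.3, one admissible datum with non-vanishing level-`0` multiplier, R4), AND for every
cyclotomic `ℤ₂`-tower `κ` with topological generator `γ`, every `I : IwasawaH1Data W_K 2 κ γ` and THE
element `𝐲 ∈ I.H` lifting `(Cor_{ℚ(μ_{2^{n+2}})/ℚ_n} z_{n+2,∅})_n` (it exists uniquely: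
`IwasawaH1Data.existsUnique_lift_of_zetaBody_two`), the structure `MemberHullInputs W_K 2 κ γ I 𝐲` is
inhabited — by `𝐇'¹(T)^{**}`, `y' = ½·cores^{**}(z̃_{γ⁺})`, the multiplier of Lemma 13.10 (1) pushed
through `cores`, the non-archimedean part of `𝐇'²(T)`, `H¹(ℤ[1/2],T)` and the maps of (14.14.1)
(module docstring, R1–R12). A CONSTRUCTION fact (D-0014): its content is that Kato's objects at his
member satisfy the listed printed statements at `p = 2`, each read through the audited steps T1–T14 of
`Kato2004/AdditivePotGoodRankZeroShaUpperBoundFineSelmerAtTwo{,Sharp}.lean` with a rational `2`-torsion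
point (hull instead of freeness; `T^{G_{ℚ(ζ)}} = 0` as a projective limit); weaker than what these give
(the identity of `F`, `H2` is forgotten), never stronger; honest scope in the module docstring («WHAT THE
ABSTRACT FIELDS DO AND DO NOT PIN»). With `nonempty_iwasawaH1Data` and modularity it yields the member
bound `ord₂ #Ш(W_K)[2^∞] + v₂ Tam(W_K) ≤ ord₂(L(W_K,1)/Ω(W_K)) + 3·ord₂ #W_K(ℚ)_tors` (consumer file).
Named fact; nothing asserted; no `_holds` expected (size XL). Flag for the referee:
`Kato-12.4-12.6-13.10-14.14-member-hull-reading-reducible-at-two` (non-verbatim steps: R3 hull form of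
T14, R4 `cores` bookkeeping, R5 non-archimedean part, R9, R12 = T7″).
[cite: Kato2004Asterisque, §8.3 (p. 181), (12.2.1) (p. 220), Thm. 12.4 (1)(2) (p. 221), Thm. 12.5 (1)–(3) and (12.5.1) (pp. 221–222), Thm. 12.6 and Rem. 12.7 (p. 222), Rem. 12.8 (p. 223), 13.8 (pp. 227–229), 13.9 and Lemma 13.10 (1) (pp. 229–230), 13.13–13.14 (pp. 233–234), Thm. 14.5 (1)(2) and `[M : z]` (pp. 236–237), §14.8 (p. 238), (14.9.1)–(14.9.5) (pp. 239–240), §14.14 (14.14.1)–(14.14.2) and Lemma 14.15 (pp. 243–244), Prop. 14.16 (2) and its proof (pp. 244–245), (8.1.3) (p. 180), Ex. 13.3 (p. 225)]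
[cite: Kato1999Kodai, Thm. 0.8 (p. 318)]
[cite: Wuthrich2014, Lemma 12 (p. 395)]
[cite: GreenbergLNM1716, Prop. 4.13 and the paragraph following its proof; §3 after Lemma 3.3]
[cite: Rubin2000, Ch. I §3–§4 and Thm. I.7.3; Ch. II Thm. 2.3] [cite: MazurRubin2004, Thm. 2.3.4]
[cite: MilneADT2006, I.2.6, I.4.10, II.2.9, II §3]
[cite: BlochKato1990, §3 Def. 3.10, Ex. 3.11, Prop. 3.8]
[cite: Lim2017FineSelmer, §3 Thm. 3.5 and the Poitou–Tate lemma] [cite: CoatesSujatha2005, statement (A) and Thm. 3.4]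
[cite: BourbakiAC5to7, VII §4 no. 2] [cite: BrunsHerzog1998, Prop. 1.4.1]
[cite: NeukirchSchmidtWingberg2008, (1.5.6)–(1.5.7), (1.6.7)]
[cite: SilvermanAEC2009, Prop. III.4.12 with Rem. III.4.13.2, IV.6.4, Thm. X.4.14] [cite: Tate1975, §1]
[cite: Washington1997, §13.1] -/
def exists_memberHullInputs_two : Prop :=
  ∀ (W : WeierstrassCurve ℚ) [W.IsElliptic] [W.IsGloballyMinimal], ¬ W.HasCM →
    ¬ W.HasGoodReductionAtPrime 2 → ¬ W.HasMultiplicativeReductionAtPrime 2 →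
    0 ≤ padicValRat 2 W.j →
    ¬ W.HasIrreducibleModPGaloisRep 2 →
    W.entireLFunction 1 ≠ 0 → Finite W.sha →
    ∃ (W' : WeierstrassCurve ℚ) (_ : W'.IsElliptic) (_ : W'.IsGloballyMinimal),
      WeierstrassCurve.IsIsogenous W W' ∧
      ∀ [ContinuousSMul ℤ_[2] (W'.tateModule 2)] [Module.Free ℤ_[2] (W'.tateModule 2)]
        [Module.Finite ℤ_[2] (W'.tateModule 2)],
      (∀ (κ : ZpExtension ℚ 2), κ.IsCyclotomic →
        ∃ (γ : absoluteGaloisGroup ℚ) (D : W'.FineSelmerDualData κ γ),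
          Module.Finite ℤ_[2] (RestrictScalars ℤ_[2] (IwasawaAlgebra 2) D.X)) →
      ∀ {N : ℕ} [NeZero N] (f : CuspForm (Gamma0 N) 2), IsNewformOf W f →
      ∀ (ι : (m : ℕ) → (CyclotomicField m ℚ →+* ℂ)),
      ∃ (κ' : ℝ) (Λ' : ∀ (k : ℕ) (r : Finset (HeightOneSpectrum (𝓞 ℚ))),
          H1 (tateRep W' 2) (cycSubgroup 2 k r) →ₗ[ℤ_[2]] ℚ_[2] ⊗[ℚ] CyclotomicField (cycLevel 2 k r) ℚ)
        (c d a : ℤ) (A : ℕ)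
        (z : ∀ (k : ℕ) (r : (cyclotomicLevelsRat 2 (badPlaces c d A N)).Ideals),
          H1 (tateRep W' 2) ((cyclotomicLevelsRat 2 (badPlaces c d A N)).level k r.1))
        (x : ∀ (k : ℕ) (r : (cyclotomicLevelsRat 2 (badPlaces c d A N)).Ideals),
          CyclotomicField (cycLevel 2 k r.1) ℚ),
        κ' ≠ 0 ∧ 0 < A ∧ Int.gcd c (6 * 2 * A) = 1 ∧ Int.gcd d (6 * 2 * N) = 1 ∧
        ZetaBody W' 2 f ι κ' Λ' c d a A z x ∧
        ∀ (κ : ZpExtension ℚ 2) (γ : absoluteGaloisGroup ℚ) (hκ : κ.IsCyclotomic),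
          κ.IsTopGenerator γ →
          ∀ (I : IwasawaH1Data W' 2 κ γ) (y : I.H),
            (∀ n : ℕ, I.proj n y = levelToLayerTwo W' hκ (badPlaces c d A N) n
              (z (n + 2) (cyclotomicLevelsRat 2 (badPlaces c d A N)).idealOne)) →
            Nonempty (MemberHullInputs W' 2 κ γ I y)

-- TODO(general form): as in `MemberHullInputs.lean` (every stable lattice, all `Δ`-components, weight
-- `k ≥ 2`), with `𝐇'²(T)` CONSTRUCTED so that `H2` is its non-archimedean part by definition, the sharp
-- Cassels cokernel `#im(E(ℚ)[2^∞] → ∏_ℓ Φ_ℓ[2^∞])` in place of `2^t`, and statement (A) at `2`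
-- discharged inside once Lim 2017 Thm. 3.5 / Ferrero–Washington are tree theorems.

end Literature.NumberTheory.EllipticCurves.Kato2004

end
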